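import Summits.ValiantsHypothesis.ValiantsHypothesis.Theorems.LacunarySymmetroidMatrixDescartesCensusDoorA34SheetHyperbolicGraft

/-!
# `MatrixDescartes` census — DOOR A at `(3,4)`: the SEMIDEFINITE SHEET at ROOT LEVEL — the two Schur branches ARE the two root types
# (`d₃`-free off-diagonal of the adjugate Gram matrix; middle-type roots = upper Gram eigenvalue, extreme-type roots = lower Gram eigenvalue; root-level sign laws)

HONEST FRAMING.  Object-search cell `pub-symmetroid`, engine seat `val-sym-eng-2` (g9); helper row beside the registered strata line
`Cruxes/DoorA34/Lines/strata.lean` on stmt-ValiantsHypothesis-19980 (`DoorA34 = PosRootLawAt 3 4 18`: OPEN, typed, never asserted here), stub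
`stub_nullTopCeiling` (`det S₃ = 0 ⇒ ≤ 17`), SEMIDEFINITE inertia cell of the singular top letter (`S₃ ⪰ 0` or `⪯ 0` of rank two: `S₃ = vvᵀ + wwᵀ` up to the
sign of the unfolding scale `s`; kernel direction `k = v × w`).  The cell's located verdict (val-sym-eng-2 g8) is that the open content of the stub is ROOT-LEVEL;
the semidefinite cell's located maximum is `16` (`Census.SemidefSixteen014100`, `Census.SemidefSixteen01440`).  This file records the exact root-level
dictionary of that cell, for ALL cores `G` (any real symmetric `3 × 3` matrix; for the sheet, `G = G(r)` is the three-letter core at a det-root `r` and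
`s = r^{d₃}`), in the currency of …SchurSheet / …SheetTwoGrafts / …SheetHyperbolicGraft:

* ring identities (any commutative ring, `F = M + a·vvᵀ + b·wwᵀ`): **`adjugate_bilin_add_two_grafts`** — `vᵀ adj(F) w = vᵀ adj(M) w`: the OFF-DIAGONAL
  entry of the adjugate Gram matrix on `(v, w)` does not see the two grafts at all (on the sheet: it is `d₃`-FREE, a six-nomial on the core's pair sums);
  `adjugate_quadForm_add_two_grafts_left/right` — `vᵀ adj(F) v = vᵀ adj(M) v + b·kᵀMk`, `wᵀ adj(F) w = wᵀ adj(M) w + a·kᵀMk`; `mulVec_add_two_grafts_cross`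
  (`F k = M k`); hence for `a = b = s` the Gram matrix of `adj F` on `(v, w)` is `Q₀ + s·kᵀMk·I₂` with `Q₀ = [[q_v, m],[m, q_w]]` the Gram matrix of `adj M`
  (`quadForm_adjugate_two_grafts_span`), and Jacobi for `F` reads `(q_v + s T)(q_w + s T) − m·m' = det F · T`, `T = kᵀMk` (`two_grafts_gram_identity`);
* **BRANCH LAW** (real symmetric `G`, `F = G + s·(vvᵀ + wwᵀ)` singular): at a root of MIDDLE type (`tr adj F < 0`) the shifted Gram form is `≤ 0` on the
  whole frame plane — `(xv + yw)ᵀ adj G (xv + yw) + s·T·(x² + y²) ≤ 0` for all `x, y` (`branchLaw_middle`) — and at a root of EXTREME type (`0 < tr adj F`)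
  it is `≥ 0` (`branchLaw_extreme`).  Since the form is singular there (`two_grafts_gram_identity`), this says exactly: `−s·T = λ_max(Q₀)` at middle-type
  roots and `−s·T = λ_min(Q₀)` at extreme-type roots — on the semidefinite sheet the two Schur branches of …SchurSheet ARE the two root types, and the probe
  is the signed three-term `−t^{d₃}·kᵀG(t)k`;
* **ROOT-LEVEL SIGN LAWS** (corollaries): `branchLaw_middle_diag` / `branchLaw_extreme_diag` (`q_v + sT`, `q_w + sT` carry the type sign);
  **`middle_root_in_top_window`** — a middle-type root with `0 < s·T` has `q_v < 0`, `q_w < 0` AND `0 < det G · T` (the core determinant and the top trinomial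
  agree in sign there); **`extreme_root_below_top_window`** — an extreme-type root with `s·T < 0` has `0 < q_v`, `0 < q_w` and `0 < det G · T`.
  (Located, this seat: on both semidefinite sixteens and on g8's coefficient-perfect ten-root triple witness every root but the last two is of middle type
  with `T < 0`, the last two are extreme with `T > 0` — the top window of the semidefinite cell is a positive-definite excursion, not a middle block.)

Nothing here bounds any count: no statement about `ζ_sym(3,4)` beyond the registers (`18 ≤ ζ_sym(3,4) ≤ 19`); `DoorA34` and all three stubs stay OPEN; nothing
on `MatrixDescartes` (stmt-ValiantsHypothesis-18050) or `VP ≠ VNP` — VP≠VNP not moved.  [folklore] rank-one updates of `3 × 3` adjugates, Jacobi's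
complementary-minor identity, the rank-one adjugate at a singular symmetric matrix; `ring` / `nlinarith`.
-/

-- `Summit.ValiantsHypothesis.ValiantsHypothesis.…` repeats a component by the D-0017 layout
-- (single-conjunct summit), which the `dupNamespace` linter flags; the name is mandated.
set_option linter.dupNamespace false

namespace Summit.ValiantsHypothesis.ValiantsHypothesis.Theorems.LacunarySymmetroidMatrixDescartes.Census

open scoped BigOperators Matrix
open Matrix

/-! ## 1. Ring identities for the two-graft top letter `a·vvᵀ + b·wwᵀ` (any `3 × 3` matrix over a commutative ring) -/

/-- **The off-diagonal Gram entry is graft-free**: `vᵀ adj(M + a·vvᵀ + b·wwᵀ) w = vᵀ adj(M) w`.  (Bordered-determinant reading: `−vᵀ adj(F) w` is the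
determinant of `F` bordered by the column `w` and the row `vᵀ`, and the two grafts are cleared by row/column operations with the borders.)  On the
null-top sheet this is the statement that the off-diagonal entry of the Schur/Gram `2 × 2` matrix does not involve `X^{d₃}`. [folklore] -/
theorem adjugate_bilin_add_two_grafts {R : Type*} [CommRing R] (M : Matrix (Fin 3) (Fin 3) R) (a b : R) (v w : Fin 3 → R) :
    v ⬝ᵥ ((M + a • Matrix.vecMulVec v v + b • Matrix.vecMulVec w w).adjugate *ᵥ w) = v ⬝ᵥ (M.adjugate *ᵥ w) := by
  simp only [Matrix.adjugate_fin_three, Matrix.add_apply, Matrix.vecMulVec_apply, Matrix.smul_apply, smul_eq_mul, Matrix.mulVec,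
    dotProduct, Fin.sum_univ_three, Matrix.of_apply, Matrix.cons_val', Matrix.cons_val_zero, Matrix.cons_val_one, Matrix.head_cons,
    Matrix.cons_val_two, Matrix.tail_cons, Matrix.empty_val', Matrix.cons_val_fin_one, Matrix.head_fin_const]
  ring

/-- The transposed off-diagonal entry is graft-free as well: `wᵀ adj(M + a·vvᵀ + b·wwᵀ) v = wᵀ adj(M) v`. [folklore] -/
theorem adjugate_bilin_add_two_grafts' {R : Type*} [CommRing R] (M : Matrix (Fin 3) (Fin 3) R) (a b : R) (v w : Fin 3 → R) :
    w ⬝ᵥ ((M + a • Matrix.vecMulVec v v + b • Matrix.vecMulVec w w).adjugate *ᵥ v) = w ⬝ᵥ (M.adjugate *ᵥ v) := by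
  simp only [Matrix.adjugate_fin_three, Matrix.add_apply, Matrix.vecMulVec_apply, Matrix.smul_apply, smul_eq_mul, Matrix.mulVec,
    dotProduct, Fin.sum_univ_three, Matrix.of_apply, Matrix.cons_val', Matrix.cons_val_zero, Matrix.cons_val_one, Matrix.head_cons,
    Matrix.cons_val_two, Matrix.tail_cons, Matrix.empty_val', Matrix.cons_val_fin_one, Matrix.head_fin_const]
  ring

/-- **Left diagonal Gram entry**: `vᵀ adj(M + a·vvᵀ + b·wwᵀ) v = vᵀ adj(M) v + b·(v × w)ᵀ M (v × w)` (the graft along `v` itself is invisible,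
the graft along `w` contributes the top trinomial). [folklore] -/
theorem adjugate_quadForm_add_two_grafts_left {R : Type*} [CommRing R] (M : Matrix (Fin 3) (Fin 3) R) (a b : R) (v w : Fin 3 → R) :
    v ⬝ᵥ ((M + a • Matrix.vecMulVec v v + b • Matrix.vecMulVec w w).adjugate *ᵥ v)
      = v ⬝ᵥ (M.adjugate *ᵥ v) + b * ((v ⨯₃ w) ⬝ᵥ (M *ᵥ (v ⨯₃ w))) := by
  simp only [Matrix.adjugate_fin_three, Matrix.add_apply, Matrix.vecMulVec_apply, Matrix.smul_apply, smul_eq_mul, Matrix.mulVec,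
    dotProduct, Fin.sum_univ_three, Matrix.of_apply, Matrix.cons_val', Matrix.cons_val_zero, Matrix.cons_val_one, Matrix.head_cons,
    Matrix.cons_val_two, Matrix.tail_cons, Matrix.empty_val', Matrix.cons_val_fin_one, Matrix.head_fin_const, cross_apply]
  ring

/-- **Right diagonal Gram entry**: `wᵀ adj(M + a·vvᵀ + b·wwᵀ) w = wᵀ adj(M) w + a·(v × w)ᵀ M (v × w)`. [folklore] -/
theorem adjugate_quadForm_add_two_grafts_right {R : Type*} [CommRing R] (M : Matrix (Fin 3) (Fin 3) R) (a b : R) (v w : Fin 3 → R) :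
    w ⬝ᵥ ((M + a • Matrix.vecMulVec v v + b • Matrix.vecMulVec w w).adjugate *ᵥ w)
      = w ⬝ᵥ (M.adjugate *ᵥ w) + a * ((v ⨯₃ w) ⬝ᵥ (M *ᵥ (v ⨯₃ w))) := by
  simp only [Matrix.adjugate_fin_three, Matrix.add_apply, Matrix.vecMulVec_apply, Matrix.smul_apply, smul_eq_mul, Matrix.mulVec,
    dotProduct, Fin.sum_univ_three, Matrix.of_apply, Matrix.cons_val', Matrix.cons_val_zero, Matrix.cons_val_one, Matrix.head_cons,
    Matrix.cons_val_two, Matrix.tail_cons, Matrix.empty_val', Matrix.cons_val_fin_one, Matrix.head_fin_const, cross_apply]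
  ring

/-- The kernel direction `k = v × w` of the top letter does not see the grafts: `(M + a·vvᵀ + b·wwᵀ) k = M k`. [folklore] -/
theorem mulVec_add_two_grafts_cross {R : Type*} [CommRing R] (M : Matrix (Fin 3) (Fin 3) R) (a b : R) (v w : Fin 3 → R) :
    (M + a • Matrix.vecMulVec v v + b • Matrix.vecMulVec w w) *ᵥ (v ⨯₃ w) = M *ᵥ (v ⨯₃ w) := by
  ext i
  fin_cases i <;>
  · simp only [Matrix.add_apply, Matrix.vecMulVec_apply, Matrix.smul_apply, smul_eq_mul, Matrix.mulVec, dotProduct, Fin.sum_univ_three,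
      cross_apply, Matrix.cons_val_zero, Matrix.cons_val_one, Matrix.head_cons, Matrix.cons_val_two, Matrix.tail_cons]
    ring

/-- Hence the top trinomial is graft-free: `kᵀ (M + a·vvᵀ + b·wwᵀ) k = kᵀ M k`, `k = v × w`. [folklore] -/
theorem cross_quadForm_add_two_grafts {R : Type*} [CommRing R] (M : Matrix (Fin 3) (Fin 3) R) (a b : R) (v w : Fin 3 → R) :
    (v ⨯₃ w) ⬝ᵥ ((M + a • Matrix.vecMulVec v v + b • Matrix.vecMulVec w w) *ᵥ (v ⨯₃ w)) = (v ⨯₃ w) ⬝ᵥ (M *ᵥ (v ⨯₃ w)) := by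
  rw [mulVec_add_two_grafts_cross]

/-- **JACOBI FOR THE GRAFTED MATRIX, in graft-free terms**: with `q_v = vᵀ adj(M) v`, `q_w = wᵀ adj(M) w`, `m = vᵀ adj(M) w`, `m' = wᵀ adj(M) v`,
`T = kᵀ M k` (`k = v × w`) and `F = M + a·vvᵀ + b·wwᵀ`:  `(q_v + b·T)·(q_w + a·T) − m·m' = det F · T`.  For `a = b = s` this is the semidefinite SHEET
IDENTITY `T·det F = det(Q₀ + s·T·I₂)`, `Q₀ = [[q_v, m],[m', q_w]]` (…SchurSheet's two-branch identity, coordinate-free). [folklore] -/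
theorem two_grafts_gram_identity {R : Type*} [CommRing R] (M : Matrix (Fin 3) (Fin 3) R) (a b : R) (v w : Fin 3 → R) :
    (v ⬝ᵥ (M.adjugate *ᵥ v) + b * ((v ⨯₃ w) ⬝ᵥ (M *ᵥ (v ⨯₃ w)))) * (w ⬝ᵥ (M.adjugate *ᵥ w) + a * ((v ⨯₃ w) ⬝ᵥ (M *ᵥ (v ⨯₃ w))))
        - (v ⬝ᵥ (M.adjugate *ᵥ w)) * (w ⬝ᵥ (M.adjugate *ᵥ v))
      = (M + a • Matrix.vecMulVec v v + b • Matrix.vecMulVec w w).det * ((v ⨯₃ w) ⬝ᵥ (M *ᵥ (v ⨯₃ w))) := by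
  have h := adjugate_gram_fin_three (M + a • Matrix.vecMulVec v v + b • Matrix.vecMulVec w w) v w
  rw [adjugate_quadForm_add_two_grafts_left, adjugate_quadForm_add_two_grafts_right, adjugate_bilin_add_two_grafts,
    adjugate_bilin_add_two_grafts', cross_quadForm_add_two_grafts] at h
  exact h

/-- **The shifted Gram form on the frame plane**: for `u = x·v + y·w` and `F = M + s·(vvᵀ + wwᵀ)`,
`uᵀ adj(F) u = uᵀ adj(M) u + s·(x² + y²)·kᵀMk` — the Gram matrix of `adj F` on `(v, w)` is `Q₀ + s·T·I₂`. [folklore] -/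
theorem quadForm_adjugate_two_grafts_span {R : Type*} [CommRing R] (M : Matrix (Fin 3) (Fin 3) R) (s x y : R) (v w : Fin 3 → R) :
    (x • v + y • w) ⬝ᵥ ((M + s • Matrix.vecMulVec v v + s • Matrix.vecMulVec w w).adjugate *ᵥ (x • v + y • w))
      = (x • v + y • w) ⬝ᵥ (M.adjugate *ᵥ (x • v + y • w)) + s * (x ^ 2 + y ^ 2) * ((v ⨯₃ w) ⬝ᵥ (M *ᵥ (v ⨯₃ w))) := by
  simp only [Matrix.adjugate_fin_three, Matrix.add_apply, Matrix.vecMulVec_apply, Matrix.smul_apply, smul_eq_mul, Matrix.mulVec,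
    dotProduct, Fin.sum_univ_three, Matrix.of_apply, Matrix.cons_val', Matrix.cons_val_zero, Matrix.cons_val_one, Matrix.head_cons,
    Matrix.cons_val_two, Matrix.tail_cons, Matrix.empty_val', Matrix.cons_val_fin_one, Matrix.head_fin_const, cross_apply,
    Pi.add_apply, Pi.smul_apply]
  ring

/-- The semidefinite two-graft letter `s·(vvᵀ + wwᵀ)` as one summand. [folklore] -/
theorem smul_vecMulVec_add (s : ℝ) (v w : Fin 3 → ℝ) (M : Matrix (Fin 3) (Fin 3) ℝ) :
    M + s • (Matrix.vecMulVec v v + Matrix.vecMulVec w w) = M + s • Matrix.vecMulVec v v + s • Matrix.vecMulVec w w := by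
  rw [smul_add, add_assoc]

/-! ## 2. The BRANCH LAW at a det-root (real symmetric core; `F = G + s·(vvᵀ + wwᵀ)` singular) -/

/-- Symmetry of the grafted matrix. [folklore] -/
theorem isSymm_add_two_grafts (G : Matrix (Fin 3) (Fin 3) ℝ) (hG : G.IsSymm) (s : ℝ) (v w : Fin 3 → ℝ) :
    (G + s • (Matrix.vecMulVec v v + Matrix.vecMulVec w w)).IsSymm := by
  unfold Matrix.IsSymm at hG ⊢
  rw [Matrix.transpose_add, Matrix.transpose_smul, Matrix.transpose_add, Matrix.transpose_vecMulVec, Matrix.transpose_vecMulVec, hG]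

/-- **BRANCH LAW, middle type.**  `G` real symmetric, `F = G + s·(vvᵀ + wwᵀ)` with `det F = 0` and `tr adj F < 0` (a det-root of MIDDLE type, the
middle eigenvalue crossing zero).  Then for every `u = x·v + y·w` of the frame plane: `uᵀ adj(G) u + s·(x² + y²)·kᵀGk ≤ 0` (`k = v × w`).  Equality
holds for some `(x, y) ≠ (0, 0)` by `two_grafts_gram_identity`, so `−s·kᵀGk` is the LARGER eigenvalue of the Gram matrix `Q₀ = [[q_v, m],[m, q_w]]`
of `adj G` on `(v, w)` w.r.t. the frame norm `x² + y²`: middle-type roots are crossings of the probe `−s·T` with the UPPER Gram branch. [folklore] -/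
theorem branchLaw_middle (G : Matrix (Fin 3) (Fin 3) ℝ) (hG : G.IsSymm) (s : ℝ) (v w : Fin 3 → ℝ)
    (hdet : (G + s • (Matrix.vecMulVec v v + Matrix.vecMulVec w w)).det = 0)
    (htype : (G + s • (Matrix.vecMulVec v v + Matrix.vecMulVec w w)).adjugate.trace < 0) (x y : ℝ) :
    (x • v + y • w) ⬝ᵥ (G.adjugate *ᵥ (x • v + y • w)) + s * (x ^ 2 + y ^ 2) * ((v ⨯₃ w) ⬝ᵥ (G *ᵥ (v ⨯₃ w))) ≤ 0 := by
  have h := quadForm_adjugate_nonpos_of_trace_adjugate_neg _ (isSymm_add_two_grafts G hG s v w) hdet htype (x • v + y • w)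
  rw [smul_vecMulVec_add, quadForm_adjugate_two_grafts_span] at h
  exact h

/-- **BRANCH LAW, extreme type.**  Same setting with `0 < tr adj F` (a det-root of EXTREME type: `F` semidefinite singular).  Then
`uᵀ adj(G) u + s·(x² + y²)·kᵀGk ≥ 0` on the whole frame plane: `−s·kᵀGk` is the SMALLER eigenvalue of `Q₀` — extreme-type roots are crossings of the
probe with the LOWER Gram branch. [folklore] -/
theorem branchLaw_extreme (G : Matrix (Fin 3) (Fin 3) ℝ) (hG : G.IsSymm) (s : ℝ) (v w : Fin 3 → ℝ)
    (hdet : (G + s • (Matrix.vecMulVec v v + Matrix.vecMulVec w w)).det = 0)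
    (htype : 0 < (G + s • (Matrix.vecMulVec v v + Matrix.vecMulVec w w)).adjugate.trace) (x y : ℝ) :
    0 ≤ (x • v + y • w) ⬝ᵥ (G.adjugate *ᵥ (x • v + y • w)) + s * (x ^ 2 + y ^ 2) * ((v ⨯₃ w) ⬝ᵥ (G *ᵥ (v ⨯₃ w))) := by
  have h := quadForm_adjugate_nonneg_of_trace_adjugate_pos _ (isSymm_add_two_grafts G hG s v w) hdet htype (x • v + y • w)
  rw [smul_vecMulVec_add, quadForm_adjugate_two_grafts_span] at h
  exact h

/-- The frame vector `1·v + 0·w`. [folklore] -/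
theorem one_smul_add_zero_smul (v w : Fin 3 → ℝ) : (1 : ℝ) • v + (0 : ℝ) • w = v := by
  rw [one_smul, zero_smul, add_zero]

/-- The frame vector `0·v + 1·w`. [folklore] -/
theorem zero_smul_add_one_smul (v w : Fin 3 → ℝ) : (0 : ℝ) • v + (1 : ℝ) • w = w := by
  rw [one_smul, zero_smul, zero_add]

/-- **Middle type, diagonal form**: `q_v + s·T ≤ 0` and `q_w + s·T ≤ 0` at a middle-type root (`q_v = vᵀ adj(G) v`, `q_w = wᵀ adj(G) w`,
`T = kᵀGk`). [folklore] -/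
theorem branchLaw_middle_diag (G : Matrix (Fin 3) (Fin 3) ℝ) (hG : G.IsSymm) (s : ℝ) (v w : Fin 3 → ℝ)
    (hdet : (G + s • (Matrix.vecMulVec v v + Matrix.vecMulVec w w)).det = 0)
    (htype : (G + s • (Matrix.vecMulVec v v + Matrix.vecMulVec w w)).adjugate.trace < 0) :
    v ⬝ᵥ (G.adjugate *ᵥ v) + s * ((v ⨯₃ w) ⬝ᵥ (G *ᵥ (v ⨯₃ w))) ≤ 0 ∧
      w ⬝ᵥ (G.adjugate *ᵥ w) + s * ((v ⨯₃ w) ⬝ᵥ (G *ᵥ (v ⨯₃ w))) ≤ 0 := by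
  have h1 := branchLaw_middle G hG s v w hdet htype 1 0
  have h2 := branchLaw_middle G hG s v w hdet htype 0 1
  rw [one_smul_add_zero_smul] at h1
  rw [zero_smul_add_one_smul] at h2
  constructor
  · nlinarith [h1]
  · nlinarith [h2]

/-- **Extreme type, diagonal form**: `0 ≤ q_v + s·T` and `0 ≤ q_w + s·T` at an extreme-type root. [folklore] -/
theorem branchLaw_extreme_diag (G : Matrix (Fin 3) (Fin 3) ℝ) (hG : G.IsSymm) (s : ℝ) (v w : Fin 3 → ℝ)
    (hdet : (G + s • (Matrix.vecMulVec v v + Matrix.vecMulVec w w)).det = 0)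
    (htype : 0 < (G + s • (Matrix.vecMulVec v v + Matrix.vecMulVec w w)).adjugate.trace) :
    0 ≤ v ⬝ᵥ (G.adjugate *ᵥ v) + s * ((v ⨯₃ w) ⬝ᵥ (G *ᵥ (v ⨯₃ w))) ∧
      0 ≤ w ⬝ᵥ (G.adjugate *ᵥ w) + s * ((v ⨯₃ w) ⬝ᵥ (G *ᵥ (v ⨯₃ w))) := by
  have h1 := branchLaw_extreme G hG s v w hdet htype 1 0
  have h2 := branchLaw_extreme G hG s v w hdet htype 0 1
  rw [one_smul_add_zero_smul] at h1
  rw [zero_smul_add_one_smul] at h2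
  constructor
  · nlinarith [h1]
  · nlinarith [h2]

/-! ## 3. ROOT-LEVEL SIGN LAWS: a middle-type root inside the positive part of the top window, an extreme-type root inside its negative part -/

/-- The Jacobi identity of the CORE on the frame: `q_v·q_w − m·m = det G · T` for symmetric `G` (`m = vᵀ adj(G) w = wᵀ adj(G) v`). [folklore] -/
theorem core_gram_identity (G : Matrix (Fin 3) (Fin 3) ℝ) (hG : G.IsSymm) (v w : Fin 3 → ℝ) :
    (v ⬝ᵥ (G.adjugate *ᵥ v)) * (w ⬝ᵥ (G.adjugate *ᵥ w)) - (v ⬝ᵥ (G.adjugate *ᵥ w)) * (v ⬝ᵥ (G.adjugate *ᵥ w))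
      = G.det * ((v ⨯₃ w) ⬝ᵥ (G *ᵥ (v ⨯₃ w))) := by
  have h := adjugate_gram_fin_three G v w
  rw [adjugate_bilin_symm G hG w v] at h
  exact h

/-- **MIDDLE-TYPE ROOT IN THE POSITIVE TOP WINDOW**: `G` real symmetric, `F = G + s·(vvᵀ + wwᵀ)` singular of middle type, and `0 < s·kᵀGk`
(the root sits where the signed top term `s·T` is positive).  Then both frame compressions of the core are negative, `q_v < 0`, `q_w < 0`, and the core
determinant has the sign of the top trinomial: `0 < det G · T`.  (The shifted Gram form is `≤ −s·T·(x² + y²) < 0`, so `Q₀` is negative definite and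
`det Q₀ = det G · T > 0`.)  On the sheet: a middle-type det-root `r` with `r^{d₃}·kᵀG(r)k > 0` has `det G(r)·kᵀG(r)k > 0` and `vᵀadj G(r)v`,
`wᵀ adj G(r) w < 0` — a root-level sign test in the currency of the blocks `det G`, `tr(adj G·S₃) = q_v + q_w`, `kᵀGk`. [folklore] -/
theorem middle_root_in_top_window (G : Matrix (Fin 3) (Fin 3) ℝ) (hG : G.IsSymm) (s : ℝ) (v w : Fin 3 → ℝ)
    (hdet : (G + s • (Matrix.vecMulVec v v + Matrix.vecMulVec w w)).det = 0)
    (htype : (G + s • (Matrix.vecMulVec v v + Matrix.vecMulVec w w)).adjugate.trace < 0)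
    (htop : 0 < s * ((v ⨯₃ w) ⬝ᵥ (G *ᵥ (v ⨯₃ w)))) :
    v ⬝ᵥ (G.adjugate *ᵥ v) < 0 ∧ w ⬝ᵥ (G.adjugate *ᵥ w) < 0 ∧ 0 < G.det * ((v ⨯₃ w) ⬝ᵥ (G *ᵥ (v ⨯₃ w))) := by
  obtain ⟨h1, h2⟩ := branchLaw_middle_diag G hG s v w hdet htype
  have hqv : v ⬝ᵥ (G.adjugate *ᵥ v) < 0 := by linarith
  have hqw : w ⬝ᵥ (G.adjugate *ᵥ w) < 0 := by linarith
  refine ⟨hqv, hqw, ?_⟩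
  -- test the shifted form at `(x, y) = (m, −q_v)`: `q_v·(q_v q_w − m²) + s T (m² + q_v²) ≤ 0`
  have hsym : w ⬝ᵥ (G.adjugate *ᵥ v) = v ⬝ᵥ (G.adjugate *ᵥ w) := (adjugate_bilin_symm G hG v w).symm
  have hgram := core_gram_identity G hG v w
  have h3 := branchLaw_middle G hG s v w hdet htype (v ⬝ᵥ (G.adjugate *ᵥ w)) (-(v ⬝ᵥ (G.adjugate *ᵥ v)))
  have hexp : ((v ⬝ᵥ (G.adjugate *ᵥ w)) • v + (-(v ⬝ᵥ (G.adjugate *ᵥ v))) • w) ⬝ᵥ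
        (G.adjugate *ᵥ ((v ⬝ᵥ (G.adjugate *ᵥ w)) • v + (-(v ⬝ᵥ (G.adjugate *ᵥ v))) • w))
      = (v ⬝ᵥ (G.adjugate *ᵥ w)) ^ 2 * (v ⬝ᵥ (G.adjugate *ᵥ v))
          - 2 * (v ⬝ᵥ (G.adjugate *ᵥ w)) * (v ⬝ᵥ (G.adjugate *ᵥ v)) * (v ⬝ᵥ (G.adjugate *ᵥ w))
          + (v ⬝ᵥ (G.adjugate *ᵥ v)) ^ 2 * (w ⬝ᵥ (G.adjugate *ᵥ w)) := by
    simp only [Matrix.mulVec_add, Matrix.mulVec_smul, dotProduct_add, dotProduct_smul, add_dotProduct, smul_dotProduct, smul_eq_mul]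
    rw [hsym]
    ring
  rw [hexp] at h3
  set qv := v ⬝ᵥ (G.adjugate *ᵥ v) with hqv_def
  set qw := w ⬝ᵥ (G.adjugate *ᵥ w) with hqw_def
  set m := v ⬝ᵥ (G.adjugate *ᵥ w) with hm_def
  set T := (v ⨯₃ w) ⬝ᵥ (G *ᵥ (v ⨯₃ w)) with hT_def
  -- `h3 : m²qv − 2m²qv + qv²qw + sT(m² + qv²) ≤ 0`, i.e. `qv·(qv qw − m²) ≤ −sT(m² + qv²) < 0`
  have hsq : 0 < m ^ 2 + qv ^ 2 := by nlinarith [sq_nonneg m, mul_pos (neg_pos.mpr hqv) (neg_pos.mpr hqv)]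
  have hpos : 0 < s * T * (m ^ 2 + qv ^ 2) := mul_pos htop hsq
  have hkey : qv * (qv * qw - m * m) < 0 := by nlinarith [h3, hpos]
  -- `qv < 0` ⇒ `qv qw − m² > 0` ⇒ `det G · T > 0`
  have hdetpos : 0 < qv * qw - m * m := by
    by_contra hle
    have hle' : qv * qw - m * m ≤ 0 := not_lt.mp hle
    have : 0 ≤ qv * (qv * qw - m * m) := mul_nonneg_of_nonpos_of_nonpos hqv.le hle'
    linarith
  rw [hgram] at hdetpos
  exact hdetpos

/-- **EXTREME-TYPE ROOT IN THE NEGATIVE TOP WINDOW**: `F = G + s·(vvᵀ + wwᵀ)` singular of extreme type (`0 < tr adj F`) with `s·kᵀGk < 0`.  Then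
`0 < q_v`, `0 < q_w` and `0 < det G · T` (`Q₀ ⪰ −s·T·I₂ ≻ 0`).  On the sheet: an extreme-type det-root `r` with `r^{d₃}·kᵀG(r)k < 0` has both frame
compressions of the core positive and `det G(r)·kᵀG(r)k > 0`. [folklore] -/
theorem extreme_root_below_top_window (G : Matrix (Fin 3) (Fin 3) ℝ) (hG : G.IsSymm) (s : ℝ) (v w : Fin 3 → ℝ)
    (hdet : (G + s • (Matrix.vecMulVec v v + Matrix.vecMulVec w w)).det = 0)
    (htype : 0 < (G + s • (Matrix.vecMulVec v v + Matrix.vecMulVec w w)).adjugate.trace)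
    (htop : s * ((v ⨯₃ w) ⬝ᵥ (G *ᵥ (v ⨯₃ w))) < 0) :
    0 < v ⬝ᵥ (G.adjugate *ᵥ v) ∧ 0 < w ⬝ᵥ (G.adjugate *ᵥ w) ∧ 0 < G.det * ((v ⨯₃ w) ⬝ᵥ (G *ᵥ (v ⨯₃ w))) := by
  obtain ⟨h1, h2⟩ := branchLaw_extreme_diag G hG s v w hdet htype
  have hqv : 0 < v ⬝ᵥ (G.adjugate *ᵥ v) := by linarith
  have hqw : 0 < w ⬝ᵥ (G.adjugate *ᵥ w) := by linarith
  refine ⟨hqv, hqw, ?_⟩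
  have hsym : w ⬝ᵥ (G.adjugate *ᵥ v) = v ⬝ᵥ (G.adjugate *ᵥ w) := (adjugate_bilin_symm G hG v w).symm
  have hgram := core_gram_identity G hG v w
  have h3 := branchLaw_extreme G hG s v w hdet htype (v ⬝ᵥ (G.adjugate *ᵥ w)) (-(v ⬝ᵥ (G.adjugate *ᵥ v)))
  have hexp : ((v ⬝ᵥ (G.adjugate *ᵥ w)) • v + (-(v ⬝ᵥ (G.adjugate *ᵥ v))) • w) ⬝ᵥ
        (G.adjugate *ᵥ ((v ⬝ᵥ (G.adjugate *ᵥ w)) • v + (-(v ⬝ᵥ (G.adjugate *ᵥ v))) • w))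
      = (v ⬝ᵥ (G.adjugate *ᵥ w)) ^ 2 * (v ⬝ᵥ (G.adjugate *ᵥ v))
          - 2 * (v ⬝ᵥ (G.adjugate *ᵥ w)) * (v ⬝ᵥ (G.adjugate *ᵥ v)) * (v ⬝ᵥ (G.adjugate *ᵥ w))
          + (v ⬝ᵥ (G.adjugate *ᵥ v)) ^ 2 * (w ⬝ᵥ (G.adjugate *ᵥ w)) := by
    simp only [Matrix.mulVec_add, Matrix.mulVec_smul, dotProduct_add, dotProduct_smul, add_dotProduct, smul_dotProduct, smul_eq_mul]
    rw [hsym]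
    ring
  rw [hexp] at h3
  set qv := v ⬝ᵥ (G.adjugate *ᵥ v) with hqv_def
  set qw := w ⬝ᵥ (G.adjugate *ᵥ w) with hqw_def
  set m := v ⬝ᵥ (G.adjugate *ᵥ w) with hm_def
  set T := (v ⨯₃ w) ⬝ᵥ (G *ᵥ (v ⨯₃ w)) with hT_def
  have hsq : 0 < m ^ 2 + qv ^ 2 := by nlinarith [sq_nonneg m, mul_pos hqv hqv]
  have hneg : s * T * (m ^ 2 + qv ^ 2) < 0 := mul_neg_of_neg_of_pos htop hsq
  have hkey : 0 < qv * (qv * qw - m * m) := by nlinarith [h3, hneg]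
  have hdetpos : 0 < qv * qw - m * m := by
    by_contra hle
    have hle' : qv * qw - m * m ≤ 0 := not_lt.mp hle
    have : qv * (qv * qw - m * m) ≤ 0 := mul_nonpos_of_nonneg_of_nonpos hqv.le hle'
    linarith
  rw [hgram] at hdetpos
  exact hdetpos

/-! ## 4. The sheet reading: the null-top pencil with a semidefinite rank-two top letter -/

/-- The null-top pencil with top letter `S₃ = vvᵀ + wwᵀ` evaluated at `t`: core plus the two-graft letter at scale `s = t^{d₃}`. [folklore] -/
theorem eval_pencil_two_grafts (d : Fin 4 → ℕ) (S : Fin 4 → Matrix (Fin 3) (Fin 3) ℝ) (v w : Fin 3 → ℝ)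
    (h3 : S 3 = Matrix.vecMulVec v v + Matrix.vecMulVec w w) (t : ℝ) :
    (∑ l, t ^ d l • S l) = (∑ l : Fin 3, t ^ d (Fin.castSucc l) • S (Fin.castSucc l)) + t ^ d 3 • (Matrix.vecMulVec v v + Matrix.vecMulVec w w) := by
  have h3' : S (Fin.last 3) = Matrix.vecMulVec v v + Matrix.vecMulVec w w := h3
  rw [Fin.sum_univ_castSucc, h3']
  rfl

/-- **BRANCH LAW ON THE SEMIDEFINITE SHEET** (all supports).  A real symmetric `(3,4)` pencil whose top letter is `S₃ = vvᵀ + wwᵀ` (the semidefinite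
rank-two cell up to sign; `k = v × w` spans `ker S₃`), a real `t` with `det F(t) = 0`:  if the root is of MIDDLE type (`tr adj F(t) < 0`) then for all `x, y`
`(xv + yw)ᵀ adj G(t) (xv + yw) + t^{d₃}·(x² + y²)·kᵀG(t)k ≤ 0`, where `G(t)` is the three-letter core — i.e. `−t^{d₃}·kᵀG(t)k = λ_max` of the Gram matrix
of `adj G(t)` on the frame; extreme type gives `≥ 0` (`= λ_min`).  This is …SchurSheet's two-branch crossing picture with the branches identified as the
two ROOT TYPES of the census. [folklore] -/
theorem nullTop_semidef_branchLaw (d : Fin 4 → ℕ) (S : Fin 4 → Matrix (Fin 3) (Fin 3) ℝ) (hS : ∀ l, (S l).IsSymm) (v w : Fin 3 → ℝ)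
    (h3 : S 3 = Matrix.vecMulVec v v + Matrix.vecMulVec w w) (t : ℝ) (hdet : (∑ l, t ^ d l • S l).det = 0) (x y : ℝ) :
    ((∑ l, t ^ d l • S l).adjugate.trace < 0 →
      (x • v + y • w) ⬝ᵥ ((∑ l : Fin 3, t ^ d (Fin.castSucc l) • S (Fin.castSucc l)).adjugate *ᵥ (x • v + y • w))
        + t ^ d 3 * (x ^ 2 + y ^ 2) * ((v ⨯₃ w) ⬝ᵥ ((∑ l : Fin 3, t ^ d (Fin.castSucc l) • S (Fin.castSucc l)) *ᵥ (v ⨯₃ w))) ≤ 0) ∧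
    (0 < (∑ l, t ^ d l • S l).adjugate.trace →
      0 ≤ (x • v + y • w) ⬝ᵥ ((∑ l : Fin 3, t ^ d (Fin.castSucc l) • S (Fin.castSucc l)).adjugate *ᵥ (x • v + y • w))
        + t ^ d 3 * (x ^ 2 + y ^ 2) * ((v ⨯₃ w) ⬝ᵥ ((∑ l : Fin 3, t ^ d (Fin.castSucc l) • S (Fin.castSucc l)) *ᵥ (v ⨯₃ w)))) := by
  have hG : (∑ l : Fin 3, t ^ d (Fin.castSucc l) • S (Fin.castSucc l)).IsSymm := by
    unfold Matrix.IsSymm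
    rw [Matrix.transpose_sum]
    refine Finset.sum_congr rfl fun l _ => ?_
    rw [Matrix.transpose_smul, (hS _)]
  rw [eval_pencil_two_grafts d S v w h3 t] at hdet ⊢
  exact ⟨fun htype => branchLaw_middle _ hG _ v w hdet htype x y, fun htype => branchLaw_extreme _ hG _ v w hdet htype x y⟩

/-! ## 5. Both inertia cells at once (appended, rev 2): for `F = G + a·vvᵀ + b·wwᵀ` the Gram form of `adj F` on the frame is `Q₀(x,y) + (b·x² + a·y²)·T`
(semidefinite cell: `a, b` of one sign; indefinite: `a·b < 0`, `h·(vwᵀ + wvᵀ) = (h/2)(v+w)(v+w)ᵀ − (h/2)(v−w)(v−w)ᵀ`; rank one: `b = 0`). -/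

/-- **Shifted Gram form, general weights**: `uᵀ adj(M + a·vvᵀ + b·wwᵀ) u = uᵀ adj(M) u + (b·x² + a·y²)·kᵀMk` for `u = x·v + y·w`. [folklore] -/
theorem quadForm_adjugate_add_two_grafts_span {R : Type*} [CommRing R] (M : Matrix (Fin 3) (Fin 3) R) (a b x y : R) (v w : Fin 3 → R) :
    (x • v + y • w) ⬝ᵥ ((M + a • Matrix.vecMulVec v v + b • Matrix.vecMulVec w w).adjugate *ᵥ (x • v + y • w))
      = (x • v + y • w) ⬝ᵥ (M.adjugate *ᵥ (x • v + y • w)) + (b * x ^ 2 + a * y ^ 2) * ((v ⨯₃ w) ⬝ᵥ (M *ᵥ (v ⨯₃ w))) := by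
  simp only [Matrix.adjugate_fin_three, Matrix.add_apply, Matrix.vecMulVec_apply, Matrix.smul_apply, smul_eq_mul, Matrix.mulVec,
    dotProduct, Fin.sum_univ_three, Matrix.of_apply, Matrix.cons_val', Matrix.cons_val_zero, Matrix.cons_val_one, Matrix.head_cons,
    Matrix.cons_val_two, Matrix.tail_cons, Matrix.empty_val', Matrix.cons_val_fin_one, Matrix.head_fin_const, cross_apply,
    Pi.add_apply, Pi.smul_apply]
  ring

/-- Symmetry of the grafted matrix, general weights. [folklore] -/
theorem isSymm_add_two_grafts' (G : Matrix (Fin 3) (Fin 3) ℝ) (hG : G.IsSymm) (a b : ℝ) (v w : Fin 3 → ℝ) :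
    (G + a • Matrix.vecMulVec v v + b • Matrix.vecMulVec w w).IsSymm := by
  unfold Matrix.IsSymm at hG ⊢
  rw [transpose_add, transpose_add, transpose_smul, transpose_smul, transpose_vecMulVec, transpose_vecMulVec, hG]

/-- **BRANCH LAW, middle type, general weights**: `F = G + a·vvᵀ + b·wwᵀ` singular, `tr adj F < 0` ⇒ the shifted form is `≤ 0`. [folklore] -/
theorem branchLaw_middle_weights (G : Matrix (Fin 3) (Fin 3) ℝ) (hG : G.IsSymm) (a b : ℝ) (v w : Fin 3 → ℝ)
    (hdet : (G + a • Matrix.vecMulVec v v + b • Matrix.vecMulVec w w).det = 0)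
    (htype : (G + a • Matrix.vecMulVec v v + b • Matrix.vecMulVec w w).adjugate.trace < 0) (x y : ℝ) :
    (x • v + y • w) ⬝ᵥ (G.adjugate *ᵥ (x • v + y • w)) + (b * x ^ 2 + a * y ^ 2) * ((v ⨯₃ w) ⬝ᵥ (G *ᵥ (v ⨯₃ w))) ≤ 0 := by
  have h := quadForm_adjugate_nonpos_of_trace_adjugate_neg _ (isSymm_add_two_grafts' G hG a b v w) hdet htype (x • v + y • w)
  rw [quadForm_adjugate_add_two_grafts_span] at h
  exact h

/-- **BRANCH LAW, extreme type, general weights**: `0 < tr adj F` ⇒ the shifted form is `≥ 0`. [folklore] -/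
theorem branchLaw_extreme_weights (G : Matrix (Fin 3) (Fin 3) ℝ) (hG : G.IsSymm) (a b : ℝ) (v w : Fin 3 → ℝ)
    (hdet : (G + a • Matrix.vecMulVec v v + b • Matrix.vecMulVec w w).det = 0)
    (htype : 0 < (G + a • Matrix.vecMulVec v v + b • Matrix.vecMulVec w w).adjugate.trace) (x y : ℝ) :
    0 ≤ (x • v + y • w) ⬝ᵥ (G.adjugate *ᵥ (x • v + y • w)) + (b * x ^ 2 + a * y ^ 2) * ((v ⨯₃ w) ⬝ᵥ (G *ᵥ (v ⨯₃ w))) := by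
  have h := quadForm_adjugate_nonneg_of_trace_adjugate_pos _ (isSymm_add_two_grafts' G hG a b v w) hdet htype (x • v + y • w)
  rw [quadForm_adjugate_add_two_grafts_span] at h
  exact h

/-! ## 6. HABITAT (blocks `D = det G`, `M = q_v + q_w`, `T = kᵀGk` at the root, `s > 0`): `T>0 ∧ D<0` extreme only; `T<0 ∧ D>0` middle only; `TD>0 ∧ MT>0` none. -/

/-- The two-graft determinant in blocks: `det(G + s·(vvᵀ + wwᵀ)) = det G + s·(q_v + q_w) + s²·kᵀGk`. [folklore] -/
theorem det_add_smul_two_grafts (G : Matrix (Fin 3) (Fin 3) ℝ) (s : ℝ) (v w : Fin 3 → ℝ) :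
    (G + s • (Matrix.vecMulVec v v + Matrix.vecMulVec w w)).det
      = G.det + s * (v ⬝ᵥ (G.adjugate *ᵥ v) + w ⬝ᵥ (G.adjugate *ᵥ w)) + s ^ 2 * ((v ⨯₃ w) ⬝ᵥ (G *ᵥ (v ⨯₃ w))) := by
  rw [smul_vecMulVec_add, det_add_two_smul_vecMulVec_fin_three]; ring

/-- **NO ROOT WHERE THE BLOCKS AGREE**: `0 ≤ T·D`, `0 < M·T`, `0 < s` ⇒ `det(G + s·(vvᵀ + wwᵀ)) ≠ 0`. [folklore] -/
theorem det_two_grafts_ne_zero_of_blocks_agree (G : Matrix (Fin 3) (Fin 3) ℝ) (s : ℝ) (hs : 0 < s) (v w : Fin 3 → ℝ)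
    (hTD : 0 ≤ ((v ⨯₃ w) ⬝ᵥ (G *ᵥ (v ⨯₃ w))) * G.det)
    (hMT : 0 < (v ⬝ᵥ (G.adjugate *ᵥ v) + w ⬝ᵥ (G.adjugate *ᵥ w)) * ((v ⨯₃ w) ⬝ᵥ (G *ᵥ (v ⨯₃ w)))) :
    (G + s • (Matrix.vecMulVec v v + Matrix.vecMulVec w w)).det ≠ 0 := by
  rw [det_add_smul_two_grafts]
  set D := G.det
  set M := v ⬝ᵥ (G.adjugate *ᵥ v) + w ⬝ᵥ (G.adjugate *ᵥ w)
  set T := (v ⨯₃ w) ⬝ᵥ (G *ᵥ (v ⨯₃ w))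
  intro h
  have h2 : T * D + s * (M * T) + s ^ 2 * T ^ 2 = 0 := by
    have := congrArg (fun z => T * z) h
    simp only [mul_zero] at this
    nlinarith [this]
  nlinarith [h2, hTD, mul_pos hs hMT, sq_nonneg (s * T)]

/-- **HABITAT, positive top window**: `0 < s·T`, `D·T ≤ 0` at a det-root ⇒ NOT middle type (`0 ≤ tr adj F`). [folklore] -/
theorem not_middle_of_top_pos_of_det_mul_top_nonpos (G : Matrix (Fin 3) (Fin 3) ℝ) (hG : G.IsSymm) (s : ℝ) (v w : Fin 3 → ℝ)
    (hdet : (G + s • (Matrix.vecMulVec v v + Matrix.vecMulVec w w)).det = 0)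
    (htop : 0 < s * ((v ⨯₃ w) ⬝ᵥ (G *ᵥ (v ⨯₃ w)))) (hDT : G.det * ((v ⨯₃ w) ⬝ᵥ (G *ᵥ (v ⨯₃ w))) ≤ 0) :
    0 ≤ (G + s • (Matrix.vecMulVec v v + Matrix.vecMulVec w w)).adjugate.trace := by
  by_contra hlt
  have htype : (G + s • (Matrix.vecMulVec v v + Matrix.vecMulVec w w)).adjugate.trace < 0 := not_le.mp hlt
  have h := (middle_root_in_top_window G hG s v w hdet htype htop).2.2
  linarith

/-- **HABITAT, negative top window**: `s·T < 0`, `D·T ≤ 0` at a det-root ⇒ NOT extreme type (`tr adj F ≤ 0`). [folklore] -/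
theorem not_extreme_of_top_neg_of_det_mul_top_nonpos (G : Matrix (Fin 3) (Fin 3) ℝ) (hG : G.IsSymm) (s : ℝ) (v w : Fin 3 → ℝ)
    (hdet : (G + s • (Matrix.vecMulVec v v + Matrix.vecMulVec w w)).det = 0)
    (htop : s * ((v ⨯₃ w) ⬝ᵥ (G *ᵥ (v ⨯₃ w))) < 0) (hDT : G.det * ((v ⨯₃ w) ⬝ᵥ (G *ᵥ (v ⨯₃ w))) ≤ 0) :
    (G + s • (Matrix.vecMulVec v v + Matrix.vecMulVec w w)).adjugate.trace ≤ 0 := by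
  by_contra hlt
  have htype : 0 < (G + s • (Matrix.vecMulVec v v + Matrix.vecMulVec w w)).adjugate.trace := not_le.mp hlt
  have h := (extreme_root_below_top_window G hG s v w hdet htype htop).2.2
  linarith

end Summit.ValiantsHypothesis.ValiantsHypothesis.Theorems.LacunarySymmetroidMatrixDescartes.Census
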